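import Literature.NumberTheory.LFunctions.GaussianLatticePieces
import Literature.NumberTheory.LFunctions.LatticeWeylDifferencing
import Literature.NumberTheory.LFunctions.GaussianHeckeZeroDensityAssembly
import HarnessLib

/-!
# The Weyl-type bound for the Hecke `L`-functions `L(s, λ^m)` of `ℤ[i]` on the critical line, and Ricci's
# zero-density theorem

Topic `Literature/NumberTheory/LFunctions`.  Everything here is PROVED; no new named facts.  This file closes the
in-tree proof of the named fact `GaussianHecke.ricci_zeroDensity`
([cite: HuangLiuRudnick2020, Thm. 3], after Ricci (1976)) by proving the Weyl-type pointwise bound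

  `‖D_m(1/2 + iτ)‖ ≤ A (m + |τ| + 2)^{1/3} log²(m + |τ| + 2)`      (`GaussianHecke.weyl_pointwise`, Kaufman 1979)

and feeding it to `GaussianHecke.ricci_zeroDensity_of_pointwise` (`GaussianHecke.ricci_zeroDensity_holds`).

The proof of the pointwise bound: a Riesz-typical-means truncation (`RieszPerron3.norm_apply_zero_le`, `x = V^{5/2}`)
reduces to the smoothed lattice sum `∑_{0 < N z ≤ x} λ^m(z) N(z)^{-iτ} N(z)^{-1/2} (1 - N z/x)³`, which is split into
`O(log V)` smooth pieces (`VdC.latticeSum_eq_pieces`); small pieces are estimated trivially, large pieces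
(`R > W^{2/3}`, `W = |w|/2π ≍ V`) by the two-dimensional van der Corput transform along lattice lines
(`VdC.norm_plainPiece_le`), and the middle pieces by a two-dimensional Weyl differencing
(`VdC.vanDerCorput_ineq_2d`) followed by the same transform for the differenced phase (`VdC.norm_diffPiece_le`).

## References

* R. M. Kaufman, *An estimate of Hecke's `L`-functions of the Gaussian field on the line `Re s = 1/2`*, Zap.
  Naučn. Sem. LOMI 91 (1979), 40–51. [Kaufman1979]
* B. Huang, J. Liu, Z. Rudnick, *Gaussian primes in almost all narrow sectors*, Acta Arith. 193 (2020), Thm. 3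
  (Ricci's zero-density estimate). [HuangLiuRudnick2020]
* E. C. Titchmarsh, *The lattice-points in a circle*, Proc. London Math. Soc. (2) 38 (1935), 96–115.
  [Titchmarsh1935Lattice]
-/

noncomputable section

open Real Set Metric Classical Finset Complex

namespace Literature.NumberTheory.LFunctions
namespace VdC

open GaussianInt GaussianHecke GaussianTheta

/-! ### Sums over boxes versus sums over `lattZ` -/

/-- A function on `ℤ[i]` supported in `lattZ X` with coordinates `< N` in absolute value has the same sum over
the box `(-N, N]²` and over `lattZ X`. [folklore] -/
theorem sum_box_eq_sum_lattZ {F : GaussianInt → ℂ} {X : ℕ} {N : ℤ}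
    (hF : ∀ z, F z ≠ 0 → z ∈ lattZ X ∧ |z.re| < N ∧ |z.im| < N) :
    ∑ p ∈ Finset.Ioc (-N) N ×ˢ Finset.Ioc (-N) N, F ⟨p.1, p.2⟩ = ∑ z ∈ lattZ X, F z := by
  classical
  set box := Finset.Ioc (-N) N ×ˢ Finset.Ioc (-N) N with hbox
  set ri : GaussianInt → ℤ × ℤ := fun z => (z.re, z.im) with hri
  have hinj : Set.InjOn ri (lattZ X : Set GaussianInt) := by
    intro z _ z' _ h
    simp only [hri, Prod.mk.injEq] at h
    exact Zsqrtd.ext h.1 h.2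
  have hL : ∑ z ∈ lattZ X, F z = ∑ p ∈ (lattZ X).image ri, F ⟨p.1, p.2⟩ := by
    rw [Finset.sum_image hinj]
  rw [hL]
  have key : ∀ p : ℤ × ℤ, F ⟨p.1, p.2⟩ ≠ 0 → p ∈ box ∧ p ∈ (lattZ X).image ri := by
    intro p hp
    obtain ⟨h1, h2, h3⟩ := hF _ hp
    simp only at h2 h3
    rw [abs_lt] at h2 h3
    refine ⟨?_, Finset.mem_image.2 ⟨⟨p.1, p.2⟩, h1, rfl⟩⟩
    rw [hbox, Finset.mem_product, Finset.mem_Ioc, Finset.mem_Ioc]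
    exact ⟨⟨h2.1, h2.2.le⟩, ⟨h3.1, h3.2.le⟩⟩
  have h1 : ∑ p ∈ box, F ⟨p.1, p.2⟩ = ∑ p ∈ box ∪ (lattZ X).image ri, F ⟨p.1, p.2⟩ :=
    Finset.sum_subset Finset.subset_union_left fun p _ hp => by
      by_contra hne; exact hp (key p hne).1
  have h2 : ∑ p ∈ (lattZ X).image ri, F ⟨p.1, p.2⟩ = ∑ p ∈ box ∪ (lattZ X).image ri, F ⟨p.1, p.2⟩ :=
    Finset.sum_subset Finset.subset_union_right fun p _ hp => by
      by_contra hne; exact hp (key p hne).2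
  rw [h1, h2]

/-! ### The support and the size of the piece weights on the lattice -/

section Support

variable {u : ℂ} {R x : ℝ} (hu : ‖u‖ = 1) (hR : 0 < R) (hx : R ^ 2 ≤ x)
include hu hR hx

/-- If `φ_T(z) ≠ 0` then `z ∈ T`, `2R² < |z|² < min(8R², x)` and `|φ_T(z)| ≤ 4/R`. [folklore] -/
theorem pwt_support {z : ℂ} (hz : pwt x R u z ≠ 0) :
    z ∈ pieceT u R ∧ 2 * R ^ 2 < ‖z‖ ^ 2 ∧ ‖z‖ ^ 2 < 8 * R ^ 2 ∧ ‖z‖ ^ 2 < x ∧ |pwt x R u z| ≤ 4 / R := by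
  have hR0 : 0 < R := hR
  have hzT : z ∈ pieceT u R := by
    by_contra h; exact hz (pwt_eq_zero_of_not_mem h)
  rw [pwt_eq_of_mem hzT] at hz ⊢
  have hrad : 2 * R ^ 2 < ‖z‖ ^ 2 ∧ ‖z‖ ^ 2 < 8 * R ^ 2 := by
    by_contra hcon
    refine hz (wt_eq_zero hR0 u ?_)
    rw [not_and_or, not_lt, not_lt] at hcon
    rcases hcon with h | h
    · exact Or.inl h
    · exact Or.inr (Or.inl h)
  have hxz : ‖z‖ ^ 2 < x := by
    by_contra hcon
    push Not at hcon
    refine hz ?_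
    rw [wt, radProf, rz, pp3]
    have hx0 : 0 < x := lt_of_lt_of_le (by positivity) hx
    have h1 : 1 ≤ ‖z‖ ^ 2 / x := by rw [le_div_iff₀ hx0]; linarith
    have : max (-(1 / x) * ‖z‖ ^ 2 + 1) 0 = 0 := max_eq_right (by
      rw [show -(1 / x) * ‖z‖ ^ 2 + 1 = 1 - ‖z‖ ^ 2 / x by ring]; linarith)
    rw [this]; simp
  exact ⟨hzT, hrad.1, hrad.2, hxz, (wt_bounds hR0 hx u 1 (pieceT_subset_wtDom hu hR0 hzT)).1⟩

/-- Gaussian integers carrying the piece weight lie in `lattZ ⌊x⌋₊` and have small coordinates. [folklore] -/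
theorem pwt_support_latt {z : GaussianInt} (hz : pwt x R u z ≠ 0) :
    z ∈ lattZ ⌊x⌋₊ ∧ |z.re| < ⌈3 * R⌉ ∧ |z.im| < ⌈3 * R⌉ ∧ z ∈ normLE ((⌈8 * R ^ 2⌉₊ : ℕ) : ℝ) := by
  obtain ⟨-, h1, h2, h3, -⟩ := pwt_support hu hR hx hz
  have hN : ((z.norm : ℝ)) = ‖(z : ℂ)‖ ^ 2 := GaussLine.norm_cast_eq_sq z
  have hn0 : (0 : ℤ) < z.norm := by
    have : (0 : ℝ) < z.norm := by rw [hN]; nlinarith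
    exact_mod_cast this
  have hnX : (z.norm : ℝ) ≤ ⌊x⌋₊ := by
    have h0 : 0 ≤ z.norm := GaussianInt.norm_nonneg z
    have e : ((z.norm.natAbs : ℕ) : ℝ) = (z.norm : ℝ) := by
      rw [← Int.cast_natCast, Int.natAbs_of_nonneg h0]
    have h3' : (z.norm : ℝ) < x := by rw [hN]; exact h3
    have hle : z.norm.natAbs ≤ ⌊x⌋₊ := Nat.le_floor (by rw [e]; exact h3'.le)
    rw [← e]; exact_mod_cast hle
  have hzn : ‖(z : ℂ)‖ < 283 / 100 * R := by nlinarith [norm_nonneg (z : ℂ)]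
  have hre : |((z.re : ℤ) : ℝ)| < ⌈3 * R⌉ := by
    have : |((z : ℂ)).re| ≤ ‖(z : ℂ)‖ := Complex.abs_re_le_norm _
    rw [← GaussianInt.intCast_re] at this
    exact lt_of_le_of_lt this (hzn.trans_le (by linarith [Int.le_ceil (3 * R)]))
  have him : |((z.im : ℤ) : ℝ)| < ⌈3 * R⌉ := by
    have : |((z : ℂ)).im| ≤ ‖(z : ℂ)‖ := Complex.abs_im_le_norm _
    rw [← GaussianInt.intCast_im] at this
    exact lt_of_le_of_lt this (hzn.trans_le (by linarith [Int.le_ceil (3 * R)]))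
  refine ⟨mem_lattZ.2 ⟨hnX, hn0⟩, by exact_mod_cast hre, by exact_mod_cast him, mem_normLE.2 ?_⟩
  rw [hN]
  exact h2.le.trans (Nat.le_ceil _)

/-- **The `ℓ¹`-norm of the piece weight on the lattice**: `∑_z |φ_T(z)| ≤ 288 R + 36/R`. [folklore] -/
theorem sum_abs_pwt_le (S : Finset GaussianInt) : ∑ z ∈ S, |pwt x R u z| ≤ 288 * R + 36 / R := by
  classical
  have hR0 : 0 < R := hR
  set M : ℕ := ⌈8 * R ^ 2⌉₊ with hM
  have hM8 : (M : ℝ) ≤ 8 * R ^ 2 + 1 := by rw [hM]; exact (Nat.ceil_lt_add_one (by positivity)).le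
  have hM1 : 1 ≤ M := by
    rw [hM, Nat.one_le_ceil_iff]; nlinarith
  have hsub : S.filter (fun z : GaussianInt => pwt x R u (z : ℂ) ≠ 0) ⊆ normLE (M : ℝ) := fun z hz => by
    rw [Finset.mem_filter] at hz
    exact (pwt_support_latt hu hR hx hz.2).2.2.2
  have hcard : ((S.filter (fun z : GaussianInt => pwt x R u (z : ℂ) ≠ 0)).card : ℝ) ≤ 9 * M :=
    le_trans (by exact_mod_cast Finset.card_le_card hsub) (card_normLE_le_nine_mul hM1)
  calc ∑ z ∈ S, |pwt x R u z| = ∑ z ∈ S.filter (fun z : GaussianInt => pwt x R u (z : ℂ) ≠ 0), |pwt x R u z| := by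
        rw [Finset.sum_filter_of_ne]; intro z _ hz; exact fun h => hz (by rw [h, abs_zero])
    _ ≤ ∑ z ∈ S.filter (fun z : GaussianInt => pwt x R u (z : ℂ) ≠ 0), 4 / R := by
        refine Finset.sum_le_sum fun z hz => ?_
        rw [Finset.mem_filter] at hz
        exact (pwt_support hu hR hx hz.2).2.2.2.2
    _ = (S.filter (fun z : GaussianInt => pwt x R u (z : ℂ) ≠ 0)).card * (4 / R) := by rw [Finset.sum_const, nsmul_eq_mul]
    _ ≤ 9 * M * (4 / R) := by gcongr
    _ ≤ 9 * (8 * R ^ 2 + 1) * (4 / R) := by gcongr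
    _ = 288 * R + 36 / R := by field_simp; ring

/-- **The trivial bound for a piece**: `‖∑_z φ_T(z) e(F(z))‖ ≤ 288 R + 36/R`. [folklore] -/
theorem norm_piece_trivial (S : Finset GaussianInt) (F : ℂ → ℝ) :
    ‖∑ z ∈ S, (pwt x R u z : ℂ) * VdC.e (F z)‖ ≤ 288 * R + 36 / R := by
  refine (norm_sum_le _ _).trans (le_trans (Finset.sum_le_sum fun z _ => ?_) (sum_abs_pwt_le hu hR hx S))
  rw [norm_mul, norm_e, mul_one, Complex.norm_real, Real.norm_eq_abs]

end Support

/-! ### The plain piece in lattice form -/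

/-- A lattice piece sum `∑_{z ∈ lattZ ⌊x⌋₊} φ(z) e(F(z))` in the line form of the piece theorems, for any weight
dominated by `pwt`. [folklore] -/
theorem sum_lattZ_eq_lines {u : ℂ} {R x : ℝ} (hu : ‖u‖ = 1) (hR : 0 < R) (hx : R ^ 2 ≤ x) (k : Fin 4)
    {φ : ℂ → ℝ} (hφ : ∀ z : ℂ, φ z ≠ 0 → pwt x R u z ≠ 0) (F : ℂ → ℝ) :
    ∑ z ∈ lattZ ⌊x⌋₊, (φ z : ℂ) * VdC.e (F z)
      = ∑ b ∈ Finset.Icc (-⌈7 * R⌉) ⌈7 * R⌉, ∑' a : ℤ,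
          (φ ((a : ℂ) * dir k + (b : ℂ) * dirE k) : ℂ) * VdC.e (F ((a : ℂ) * dir k + (b : ℂ) * dirE k)) := by
  classical
  have hR0 : 0 < R := hR
  set f : ℂ → ℂ := fun z => (φ z : ℂ) * VdC.e (F z) with hf
  have hfne : ∀ z : ℂ, f z ≠ 0 → pwt x R u z ≠ 0 := fun z hz => hφ z (fun h => hz (by rw [hf]; dsimp only; rw [h]; simp))
  have h1 : ∑ z ∈ lattZ ⌊x⌋₊, f z = ∑ z ∈ normLE ((⌊x⌋₊ : ℕ) : ℝ), f z := by
    rw [lattZ, Finset.sum_filter_of_ne]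
    intro z _ hz
    exact (mem_lattZ.1 (pwt_support_latt hu hR hx (hfne _ hz)).1).2
  change ∑ z ∈ lattZ ⌊x⌋₊, f z = ∑ b ∈ Finset.Icc (-⌈7 * R⌉) ⌈7 * R⌉, ∑' a : ℤ, f ((a : ℂ) * dir k + (b : ℂ) * dirE k)
  rw [h1]
  refine sum_normLE_eq_sum_lines k (ϱ := 40 * R / 9) (fun z hz => ?_) (fun z hz => ?_) ?_
  · exact (norm_bounds_of_mem_pieceT hu hR0 (pwt_support hu hR hx (hfne z hz)).1).2
  · exact (mem_lattZ.1 (pwt_support_latt hu hR hx (hfne _ hz)).1).1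
  · have := Int.le_ceil (7 * R); linarith

/-- **The plain piece bound in lattice form** (`R ≥ 10¹⁰`, `R² ≤ x`):
`‖∑_z φ_T(z) e(F_u(z))‖ ≤ 4 K C_S² (log(1+W)+4)(W/R + W²/R³ + 1 + R/W)`, `W = ‖w‖/2π`.
[cite: Titchmarsh1935Lattice] [cite: Kaufman1979] -/
theorem norm_piece_plain {w u : ℂ} {R x : ℝ} (hu : ‖u‖ = 1) (hw : w ≠ 0) (hR : (10 : ℝ) ^ 10 ≤ R) (hx : R ^ 2 ≤ x) :
    ‖∑ z ∈ lattZ ⌊x⌋₊, (pwt x R u z : ℂ) * VdC.e ((logPhase w u z).im)‖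
      ≤ pieceK * stepC ^ 2 * (Real.log (1 + ‖w‖ / (2 * π)) + 4) * 4 *
          ((‖w‖ / (2 * π)) / R + (‖w‖ / (2 * π)) ^ 2 / R ^ 3 + 1 + R / (‖w‖ / (2 * π))) := by
  have hR1 : 0 < R := lt_of_lt_of_le (by norm_num) hR
  obtain ⟨k, hk⟩ := norm_plainPiece_le (x := x) hu hw hR hx
  rw [sum_lattZ_eq_lines hu hR1 hx k (fun z hz => hz) (fun z => (logPhase w u z).im)]
  exact hk

/-! ### The `ℓ∞`-size of a shift and the sum of its reciprocals -/

/-- `|δ|_∞ = max(|δ₁|, |δ₂|)`. [folklore] -/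
def linf (δ : ℤ × ℤ) : ℕ := max δ.1.natAbs δ.2.natAbs

/-- Basic facts: `|δ|_∞ ≥ 1` for `δ ≠ 0`; `|δ|_∞ < H` on `(-H, H)²`; `|δ|_∞ ≤ ‖δ₁ + δ₂ i‖ ≤ (3/2)|δ|_∞`. [folklore] -/
theorem linf_facts (δ : ℤ × ℤ) :
    (δ ≠ 0 → 1 ≤ linf δ) ∧ (∀ H : ℕ, δ ∈ Finset.Ioo (-(H : ℤ)) H ×ˢ Finset.Ioo (-(H : ℤ)) H → linf δ < H) ∧
      ((linf δ : ℝ) ≤ ‖((δ.1 : ℂ) + (δ.2 : ℂ) * I)‖) ∧ (‖((δ.1 : ℂ) + (δ.2 : ℂ) * I)‖ ≤ 3 / 2 * linf δ) := by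
  have hn : ‖((δ.1 : ℂ) + (δ.2 : ℂ) * I)‖ ^ 2 = (δ.1 : ℝ) ^ 2 + (δ.2 : ℝ) ^ 2 := by
    rw [Complex.sq_norm, Complex.normSq_apply]; simp; ring
  have h0 : 0 ≤ ‖((δ.1 : ℂ) + (δ.2 : ℂ) * I)‖ := norm_nonneg _
  have ha : ((δ.1.natAbs : ℕ) : ℝ) = |(δ.1 : ℝ)| := by rw [← Int.cast_natCast, Int.natCast_natAbs, Int.cast_abs]
  have hb : ((δ.2.natAbs : ℕ) : ℝ) = |(δ.2 : ℝ)| := by rw [← Int.cast_natCast, Int.natCast_natAbs, Int.cast_abs]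
  have hl : (linf δ : ℝ) = max |(δ.1 : ℝ)| |(δ.2 : ℝ)| := by rw [linf, Nat.cast_max, ha, hb]
  refine ⟨fun hδ => ?_, fun H hH => ?_, ?_, ?_⟩
  · rw [linf]
    by_contra h
    push Not at h
    have h1 : δ.1.natAbs = 0 := by omega
    have h2 : δ.2.natAbs = 0 := by omega
    exact hδ (Prod.ext (Int.natAbs_eq_zero.1 h1) (Int.natAbs_eq_zero.1 h2))
  · rw [Finset.mem_product, Finset.mem_Ioo, Finset.mem_Ioo] at hH
    rw [linf]
    omega
  · rw [hl]
    have h1 : |(δ.1 : ℝ)| ≤ ‖((δ.1 : ℂ) + (δ.2 : ℂ) * I)‖ :=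
      abs_le.2 (abs_le_of_sq_le_sq' (by rw [hn]; nlinarith [sq_nonneg (δ.2 : ℝ)]) h0)
    have h2 : |(δ.2 : ℝ)| ≤ ‖((δ.1 : ℂ) + (δ.2 : ℂ) * I)‖ :=
      abs_le.2 (abs_le_of_sq_le_sq' (by rw [hn]; nlinarith [sq_nonneg (δ.1 : ℝ)]) h0)
    exact max_le h1 h2
  · rw [hl]
    have hm : 0 ≤ max |(δ.1 : ℝ)| |(δ.2 : ℝ)| := le_trans (abs_nonneg _) (le_max_left _ _)
    apply abs_le_of_sq_le_sq' _ (by positivity) |>.2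
    rw [hn]
    nlinarith [sq_abs (δ.1 : ℝ), sq_abs (δ.2 : ℝ), le_max_left |(δ.1 : ℝ)| |(δ.2 : ℝ)|,
      le_max_right |(δ.1 : ℝ)| |(δ.2 : ℝ)|, abs_nonneg (δ.1 : ℝ), abs_nonneg (δ.2 : ℝ)]

/-- The number of shifts of a given `ℓ∞`-size `r ≥ 1` is at most `12r`. [folklore] -/
theorem card_linf_eq_le (D : Finset (ℤ × ℤ)) {r : ℕ} (hr : 1 ≤ r) : ((D.filter (fun δ => linf δ = r)).card : ℝ) ≤ 12 * r := by
  classical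
  set E : Finset (ℤ × ℤ) := ({-(r : ℤ), (r : ℤ)} ×ˢ Finset.Icc (-(r : ℤ)) r) ∪ (Finset.Icc (-(r : ℤ)) r ×ˢ {-(r : ℤ), (r : ℤ)})
    with hE
  have hsub : D.filter (fun δ => linf δ = r) ⊆ E := by
    intro δ hδ
    rw [Finset.mem_filter] at hδ
    have h := hδ.2
    rw [linf] at h
    rw [hE, Finset.mem_union, Finset.mem_product, Finset.mem_product, Finset.mem_insert, Finset.mem_singleton,
      Finset.mem_insert, Finset.mem_singleton, Finset.mem_Icc, Finset.mem_Icc]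
    rcases le_total δ.1.natAbs δ.2.natAbs with h12 | h12
    · rw [max_eq_right h12] at h
      right
      refine ⟨⟨by omega, by omega⟩, by omega⟩
    · rw [max_eq_left h12] at h
      left
      refine ⟨by omega, ⟨by omega, by omega⟩⟩
  have hcardE : (E.card : ℝ) ≤ 12 * r := by
    have h1 : E.card ≤ 2 * (2 * r + 1) + (2 * r + 1) * 2 := by
      rw [hE]
      refine (Finset.card_union_le _ _).trans (add_le_add ?_ ?_)
      · rw [Finset.card_product, Int.card_Icc]
        refine Nat.mul_le_mul (Finset.card_le_two) (le_of_eq ?_)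
        rw [show (r : ℤ) + 1 - -(r : ℤ) = ((2 * r + 1 : ℕ) : ℤ) by push_cast; ring, Int.toNat_natCast]
      · rw [Finset.card_product, Int.card_Icc]
        refine Nat.mul_le_mul (le_of_eq ?_) (Finset.card_le_two)
        rw [show (r : ℤ) + 1 - -(r : ℤ) = ((2 * r + 1 : ℕ) : ℤ) by push_cast; ring, Int.toNat_natCast]
    have h2 : (E.card : ℝ) ≤ ((2 * (2 * r + 1) + (2 * r + 1) * 2 : ℕ) : ℝ) := by exact_mod_cast h1
    refine h2.trans ?_
    push_cast
    have : (1 : ℝ) ≤ r := by exact_mod_cast hr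
    linarith
  exact le_trans (by exact_mod_cast Finset.card_le_card hsub) hcardE

/-- **`∑_{0 < |δ|_∞ < H} 1/|δ|_∞ ≤ 12 H`** (indeed `≤ 12(H-1)`). [folklore] -/
theorem sum_inv_linf_le (H : ℕ) :
    ∑ δ ∈ (Finset.Ioo (-(H : ℤ)) H ×ˢ Finset.Ioo (-(H : ℤ)) H).filter (fun δ => δ ≠ 0), (1 : ℝ) / linf δ
      ≤ 12 * (H : ℝ) := by
  classical
  set D := (Finset.Ioo (-(H : ℤ)) H ×ˢ Finset.Ioo (-(H : ℤ)) H).filter (fun δ => δ ≠ 0) with hD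
  have hmaps : ∀ δ ∈ D, linf δ ∈ Finset.Ico 1 H := by
    intro δ hδ
    rw [hD, Finset.mem_filter] at hδ
    rw [Finset.mem_Ico]
    exact ⟨(linf_facts δ).1 hδ.2, (linf_facts δ).2.1 H hδ.1⟩
  rw [← Finset.sum_fiberwise_of_maps_to hmaps]
  have hfib : ∀ r ∈ Finset.Ico 1 H, ∑ δ ∈ D.filter (fun δ => linf δ = r), (1 : ℝ) / linf δ ≤ 12 := by
    intro r hr
    rw [Finset.mem_Ico] at hr
    have hr0 : (0 : ℝ) < r := by exact_mod_cast hr.1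
    calc ∑ δ ∈ D.filter (fun δ => linf δ = r), (1 : ℝ) / linf δ = ∑ δ ∈ D.filter (fun δ => linf δ = r), (1 : ℝ) / r := by
          refine Finset.sum_congr rfl fun δ hδ => ?_
          rw [Finset.mem_filter] at hδ; rw [hδ.2]
      _ = (D.filter (fun δ => linf δ = r)).card * (1 / r) := by rw [Finset.sum_const, nsmul_eq_mul]
      _ ≤ 12 * r * (1 / r) := by gcongr; exact card_linf_eq_le D hr.1
      _ = 12 := by field_simp
  calc ∑ r ∈ Finset.Ico 1 H, ∑ δ ∈ D.filter (fun δ => linf δ = r), (1 : ℝ) / linf δ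
      ≤ ∑ r ∈ Finset.Ico 1 H, (12 : ℝ) := Finset.sum_le_sum hfib
    _ ≤ 12 * (H : ℝ) := by
        rw [Finset.sum_const, nsmul_eq_mul, Nat.card_Ico]
        have : ((H - 1 : ℕ) : ℝ) ≤ H := by exact_mod_cast Nat.sub_le H 1
        linarith

/-- The number of shifts in `(-H, H)²` is at most `4H²`. [folklore] -/
theorem card_shifts_le (H : ℕ) :
    (((Finset.Ioo (-(H : ℤ)) H ×ˢ Finset.Ioo (-(H : ℤ)) H).filter (fun δ => δ ≠ 0)).card : ℝ) ≤ 4 * (H : ℝ) ^ 2 := by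
  have h1 : ((Finset.Ioo (-(H : ℤ)) H ×ˢ Finset.Ioo (-(H : ℤ)) H).filter (fun δ => δ ≠ 0)).card
      ≤ (Finset.Ioo (-(H : ℤ)) H ×ˢ Finset.Ioo (-(H : ℤ)) H).card := Finset.card_filter_le _ _
  have h2 : ((Finset.Ioo (-(H : ℤ)) H ×ˢ Finset.Ioo (-(H : ℤ)) H).card : ℝ) ≤ 4 * (H : ℝ) ^ 2 := by
    rw [Finset.card_product, Int.card_Ioo]
    rcases Nat.eq_zero_or_pos H with h | h
    · subst h; simp
    · have : ((H : ℤ) - -(H : ℤ) - 1).toNat = 2 * H - 1 := by omega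
      rw [this]
      have h3 : ((2 * H - 1 : ℕ) : ℝ) ≤ 2 * H := by
        rw [Nat.cast_sub (by omega)]; push_cast; linarith
      push_cast
      nlinarith [h3, show (0 : ℝ) ≤ ((2 * H - 1 : ℕ) : ℝ) from by positivity]
  exact le_trans (by exact_mod_cast h1) h2


/-! ### Arithmetic of the differencing step -/

section DiffArith

set_option maxHeartbeats 400000 in
/-- The bound for one differenced piece in terms of `H` and `|δ|_∞`. [folklore] -/
theorem diffB_le {C R t H nh r : ℝ} (hC : 1 ≤ C) (ht : 1 ≤ t) (hR : 1 ≤ R) (hr1 : 1 ≤ r) (hrn : r ≤ nh)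
    (hnH : nh ≤ 3 / 2 * H) (hH : H ≤ R / (300 * t)) (hH0 : 0 < H) :
    pieceK * C ^ 2 * (Real.log (1 + 3 * nh * t ^ 3 / R ^ 3 * R ^ 2) + 4) * (16 / R ^ 2 * R) *
        (3 * nh * t ^ 3 / R ^ 3 * R + (3 * nh * t ^ 3 / R ^ 3) ^ 2 * R + 1 + 1 / (3 * nh * t ^ 3 / R ^ 3 * R))
      ≤ pieceK * C ^ 2 * (Real.log (1 + t ^ 3) + 4) * (16 / R) *
          (9 / 2 * H * t ^ 3 / R ^ 2 + 81 / 4 * H ^ 2 * t ^ 6 / R ^ 5 + 1)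
        + pieceK * C ^ 2 * (Real.log (1 + t ^ 3) + 4) * (16 * R / (3 * t ^ 3)) * (1 / r) := by
  have hK : (0 : ℝ) < pieceK := by rw [pieceK]; positivity
  have hR0 : 0 < R := by linarith
  have ht0 : 0 < t := by linarith
  have hnh0 : 0 < nh := by linarith
  have hW : (1 : ℝ) ≤ t ^ 3 := one_le_pow₀ ht
  set W := t ^ 3 with hWdef
  set LW := Real.log (1 + W) + 4 with hLW
  have hLW0 : 4 ≤ LW := by
    have : 0 ≤ Real.log (1 + W) := Real.log_nonneg (by linarith); linarith
  -- the logarithm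
  have hnhR : 3 * nh / R ≤ 1 := by
    rw [div_le_one hR0]
    have : H ≤ R / 300 := hH.trans (div_le_div_of_nonneg_left hR0.le (by norm_num) (by nlinarith))
    linarith
  have hW0 : 0 < W := by positivity
  have h3R : 3 * nh ≤ R := by rwa [div_le_one hR0] at hnhR
  have hlog : Real.log (1 + 3 * nh * W / R ^ 3 * R ^ 2) ≤ Real.log (1 + W) := by
    refine Real.log_le_log (by positivity) ?_
    rw [div_mul_eq_mul_div, add_le_add_iff_left, div_le_iff₀ (by positivity)]
    have key : 0 ≤ (R - 3 * nh) * (W * R ^ 2) := mul_nonneg (by linarith) (by positivity)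
    nlinarith [key]
  have hlog0 : 0 ≤ Real.log (1 + 3 * nh * W / R ^ 3 * R ^ 2) := Real.log_nonneg (by
    have : 0 ≤ 3 * nh * W / R ^ 3 * R ^ 2 := by positivity
    linarith)
  -- the bracket
  have e16 : 16 / R ^ 2 * R = 16 / R := by
    rw [div_mul_eq_mul_div, div_eq_div_iff (by positivity) hR0.ne']; ring
  have b1 : 3 * nh * W / R ^ 3 * R ≤ 9 / 2 * H * W / R ^ 2 := by
    rw [div_mul_eq_mul_div, div_le_div_iff₀ (by positivity) (by positivity)]
    have key : 0 ≤ (9 / 2 * H - 3 * nh) * (W * R ^ 3) := mul_nonneg (by linarith) (by positivity)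
    nlinarith [key]
  have b2 : (3 * nh * W / R ^ 3) ^ 2 * R ≤ 81 / 4 * H ^ 2 * W ^ 2 / R ^ 5 := by
    rw [div_pow, div_mul_eq_mul_div, div_le_div_iff₀ (by positivity) (by positivity)]
    have k1 : (3 * nh) ^ 2 ≤ (9 / 2 * H) ^ 2 := pow_le_pow_left₀ (by positivity) (by linarith) 2
    have key : 0 ≤ ((9 / 2 * H) ^ 2 - (3 * nh) ^ 2) * (W ^ 2 * R ^ 6) := mul_nonneg (by linarith) (by positivity)
    nlinarith [key]
  have b3 : 1 / (3 * nh * W / R ^ 3 * R) ≤ R ^ 2 / (3 * W) * (1 / r) := by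
    rw [div_mul_eq_mul_div, one_div_div, div_mul_div_comm, mul_one, div_le_div_iff₀ (by positivity) (by positivity)]
    have key : 0 ≤ (nh - r) * (3 * W * R ^ 3) := mul_nonneg (by linarith) (by positivity)
    nlinarith [key]
  rw [e16]
  have hfac : 0 ≤ pieceK * C ^ 2 * (Real.log (1 + 3 * nh * W / R ^ 3 * R ^ 2) + 4) * (16 / R) := by positivity
  calc pieceK * C ^ 2 * (Real.log (1 + 3 * nh * W / R ^ 3 * R ^ 2) + 4) * (16 / R) *
        (3 * nh * W / R ^ 3 * R + (3 * nh * W / R ^ 3) ^ 2 * R + 1 + 1 / (3 * nh * W / R ^ 3 * R))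
      ≤ pieceK * C ^ 2 * (Real.log (1 + 3 * nh * W / R ^ 3 * R ^ 2) + 4) * (16 / R) *
        (9 / 2 * H * W / R ^ 2 + 81 / 4 * H ^ 2 * W ^ 2 / R ^ 5 + 1 + R ^ 2 / (3 * W) * (1 / r)) :=
        mul_le_mul_of_nonneg_left (by linarith) hfac
    _ ≤ pieceK * C ^ 2 * LW * (16 / R) *
        (9 / 2 * H * W / R ^ 2 + 81 / 4 * H ^ 2 * W ^ 2 / R ^ 5 + 1 + R ^ 2 / (3 * W) * (1 / r)) := by
        refine mul_le_mul_of_nonneg_right ?_ (by positivity)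
        refine mul_le_mul_of_nonneg_right ?_ (by positivity)
        exact mul_le_mul_of_nonneg_left (by linarith) (by positivity)
    _ = pieceK * C ^ 2 * LW * (16 / R) * (9 / 2 * H * W / R ^ 2 + 81 / 4 * H ^ 2 * W ^ 2 / R ^ 5 + 1)
        + pieceK * C ^ 2 * LW * (16 * R / (3 * W)) * (1 / r) := by
        have : (16 / R) * (R ^ 2 / (3 * W)) = 16 * R / (3 * W) := by
          rw [div_mul_div_comm, div_eq_div_iff (by positivity) (by positivity)]; ring
        rw [mul_add (pieceK * C ^ 2 * LW * (16 / R)), ← this]; ring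
    _ = _ := by rw [hWdef]; ring

set_option maxHeartbeats 1000000 in
/-- The final combination of the differencing step. [folklore] -/
theorem diff_arith {R t H C LW S : ℝ} (ht : 1 ≤ t) (hR1 : 600 * t ≤ R) (hR2 : R ≤ t ^ 2) (hH1 : R / (600 * t) ≤ H)
    (hH2 : H ≤ R / (300 * t)) (hC : 1 ≤ C) (hLW : 4 ≤ LW) (hS : 0 ≤ S)
    (h : H ^ 2 * S ^ 2 ≤ (7 * R) ^ 2 * (1320 + 4 * H ^ 2 *
        (pieceK * C ^ 2 * LW * (16 / R) * (9 / 2 * H * t ^ 3 / R ^ 2 + 81 / 4 * H ^ 2 * t ^ 6 / R ^ 5 + 1))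
        + 12 * H * (pieceK * C ^ 2 * LW * (16 * R / (3 * t ^ 3))))) :
    S ≤ 14 * 10 ^ 13 * C * Real.sqrt LW * t := by
  have ht0 : 0 < t := by linarith
  have hR0 : 0 < R := by nlinarith
  have hH0 : 0 < H := lt_of_lt_of_le (by positivity) hH1
  have hK : pieceK = 10 ^ 22 := by rw [pieceK]
  -- the monomial bounds
  have m1 : R ^ 2 / H ^ 2 ≤ 360000 * t ^ 2 := by
    have : R / H ≤ 600 * t := by
      rw [div_le_iff₀ hH0]
      have := (div_le_iff₀ (by positivity : (0:ℝ) < 600 * t)).1 hH1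
      linarith
    have h0 : 0 ≤ R / H := by positivity
    calc R ^ 2 / H ^ 2 = (R / H) ^ 2 := by rw [div_pow]
      _ ≤ (600 * t) ^ 2 := pow_le_pow_left₀ h0 this 2
      _ = 360000 * t ^ 2 := by ring
  have hHt : H * t ≤ R / 300 := by
    have := (le_div_iff₀ (by positivity : (0:ℝ) < 300 * t)).1 hH2
    rw [le_div_iff₀ (by norm_num : (0:ℝ) < 300)]; nlinarith
  have m2 : H * t ^ 3 / R ≤ t ^ 2 / 300 := by
    rw [div_le_div_iff₀ hR0 (by norm_num)]
    nlinarith [pow_pos ht0 2]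
  have m3 : H ^ 2 * t ^ 6 / R ^ 4 ≤ t ^ 2 := by
    rw [div_le_iff₀ (by positivity)]
    have h1 : (H * t) ^ 2 ≤ (R / 300) ^ 2 := pow_le_pow_left₀ (by positivity) hHt 2
    have h2 : t ^ 2 ≤ R ^ 2 := by nlinarith
    have h3 : H ^ 2 * t ^ 6 = (H * t) ^ 2 * t ^ 2 * t ^ 2 := by ring
    rw [h3]
    have h4 : (H * t) ^ 2 * t ^ 2 * t ^ 2 ≤ (R / 300) ^ 2 * R ^ 2 * t ^ 2 := by
      have := mul_le_mul h1 h2 (by positivity) (by positivity)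
      exact mul_le_mul_of_nonneg_right this (by positivity)
    refine h4.trans ?_
    have : (R / 300) ^ 2 * R ^ 2 * t ^ 2 = t ^ 2 * R ^ 4 / 90000 := by ring
    rw [this]
    have : 0 ≤ t ^ 2 * R ^ 4 := by positivity
    linarith
  have m4 : R ^ 3 / (t ^ 3 * H) ≤ 600 * t ^ 2 := by
    have hinvH : 1 / H ≤ 600 * t / R := by
      rw [div_le_div_iff₀ hH0 hR0]
      calc 1 * R = R / (600 * t) * (600 * t) := by field_simp
        _ ≤ H * (600 * t) := mul_le_mul_of_nonneg_right hH1 (by positivity)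
        _ = 600 * t * H := by ring
    have hR4 : R ^ 2 ≤ t ^ 4 := by nlinarith
    calc R ^ 3 / (t ^ 3 * H) = R ^ 3 / t ^ 3 * (1 / H) := by rw [div_mul_div_comm, mul_one]
      _ ≤ R ^ 3 / t ^ 3 * (600 * t / R) := mul_le_mul_of_nonneg_left hinvH (by positivity)
      _ = 600 * (R ^ 2 / t ^ 2) := by
          rw [div_mul_div_comm, mul_div_assoc', div_eq_div_iff (by positivity) (by positivity)]; ring
      _ ≤ 600 * t ^ 2 := by
          refine mul_le_mul_of_nonneg_left ?_ (by norm_num)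
          rw [div_le_iff₀ (by positivity)]; nlinarith
  -- divide by `H²`
  have h' : S ^ 2 ≤ 49 * (1320 * (R ^ 2 / H ^ 2))
      + pieceK * C ^ 2 * LW * (14112 * (H * t ^ 3 / R) + 63504 * (H ^ 2 * t ^ 6 / R ^ 4) + 3136 * R)
      + 3136 * pieceK * C ^ 2 * LW * (R ^ 3 / (t ^ 3 * H)) := by
    have hH2 : 0 < H ^ 2 := by positivity
    have e : (7 * R) ^ 2 * (1320 + 4 * H ^ 2 *
        (pieceK * C ^ 2 * LW * (16 / R) * (9 / 2 * H * t ^ 3 / R ^ 2 + 81 / 4 * H ^ 2 * t ^ 6 / R ^ 5 + 1))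
        + 12 * H * (pieceK * C ^ 2 * LW * (16 * R / (3 * t ^ 3))))
        = H ^ 2 * (49 * (1320 * (R ^ 2 / H ^ 2))
          + pieceK * C ^ 2 * LW * (14112 * (H * t ^ 3 / R) + 63504 * (H ^ 2 * t ^ 6 / R ^ 4) + 3136 * R)
          + 3136 * pieceK * C ^ 2 * LW * (R ^ 3 / (t ^ 3 * H))) := by
      field_simp
      ring
    rw [e] at h
    exact le_of_mul_le_mul_left h hH2
  have hK1 : (24 * 10 ^ 9 : ℝ) ≤ pieceK := by rw [hK]; norm_num
  have hK2 : pieceK ≤ (10 : ℝ) ^ 22 := by rw [hK]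
  have hK0 : (0 : ℝ) < pieceK := lt_of_lt_of_le (by norm_num) hK1
  have hCL : 1 ≤ C ^ 2 * LW := by nlinarith
  have hX0 : 0 ≤ C ^ 2 * LW * t ^ 2 := by positivity
  have hbig : S ^ 2 ≤ (14 * 10 ^ 13 * C * Real.sqrt LW * t) ^ 2 := by
    have hsq : Real.sqrt LW ^ 2 = LW := Real.sq_sqrt (by linarith)
    rw [mul_pow, mul_pow, mul_pow, hsq]
    have x1 : 0 ≤ pieceK * C ^ 2 * LW := by positivity
    have y1 : 49 * (1320 * (R ^ 2 / H ^ 2)) ≤ 23285 * 10 ^ 6 * t ^ 2 := by nlinarith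
    have y2 : pieceK * C ^ 2 * LW * (14112 * (H * t ^ 3 / R) + 63504 * (H ^ 2 * t ^ 6 / R ^ 4) + 3136 * R)
        ≤ pieceK * C ^ 2 * LW * (66688 * t ^ 2) := mul_le_mul_of_nonneg_left (by nlinarith) x1
    have y3 : 3136 * pieceK * C ^ 2 * LW * (R ^ 3 / (t ^ 3 * H)) ≤ 3136 * pieceK * C ^ 2 * LW * (600 * t ^ 2) :=
      mul_le_mul_of_nonneg_left m4 (by positivity)
    have y4 : 23285 * 10 ^ 6 * t ^ 2 ≤ pieceK * C ^ 2 * LW * t ^ 2 := by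
      have h1 : 23285 * 10 ^ 6 * t ^ 2 ≤ pieceK * t ^ 2 := mul_le_mul_of_nonneg_right (by linarith) (by positivity)
      have h2 : pieceK * t ^ 2 ≤ pieceK * (C ^ 2 * LW) * t ^ 2 := by
        refine mul_le_mul_of_nonneg_right ?_ (by positivity)
        exact le_mul_of_one_le_right hK0.le hCL
      linarith only [h1, h2]
    have hQ : pieceK * C ^ 2 * LW * t ^ 2 ≤ 10 ^ 22 * (C ^ 2 * LW * t ^ 2) := by
      rw [show pieceK * C ^ 2 * LW * t ^ 2 = pieceK * (C ^ 2 * LW * t ^ 2) by ring]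
      exact mul_le_mul_of_nonneg_right hK2 hX0
    have hfin : S ^ 2 ≤ 1948289 * (pieceK * C ^ 2 * LW * t ^ 2) := by linarith only [h', y1, y2, y3, y4]
    have hfin2 : 1948289 * (pieceK * C ^ 2 * LW * t ^ 2) ≤ 1948289 * (10 ^ 22 * (C ^ 2 * LW * t ^ 2)) :=
      mul_le_mul_of_nonneg_left hQ (by norm_num)
    have hnum : 1948289 * (10 ^ 22 * (C ^ 2 * LW * t ^ 2)) ≤ (14 * 10 ^ 13) ^ 2 * C ^ 2 * LW * t ^ 2 := by
      rw [show (14 * 10 ^ 13 : ℝ) ^ 2 * C ^ 2 * LW * t ^ 2 = 196 * 10 ^ 26 * (C ^ 2 * LW * t ^ 2) by ring]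
      nlinarith [hX0]
    linarith only [hfin, hfin2, hnum]
  have hpos : 0 ≤ 14 * 10 ^ 13 * C * Real.sqrt LW * t := by positivity
  exact (pow_le_pow_iff_left₀ hS hpos (by norm_num : (2 : ℕ) ≠ 0)).1 hbig

end DiffArith

/-! ### The differenced pieces: Weyl differencing -/

/-- The correlation of the piece summand at a nonzero shift is the differenced piece summand. [folklore] -/
theorem corr_term_eq {w u : ℂ} {R x : ℝ} (p δ : ℤ × ℤ) :
    ((pwt x R u (((p + δ).1 : ℂ) + ((p + δ).2 : ℂ) * I) : ℂ) *
        VdC.e ((logPhase w u (((p + δ).1 : ℂ) + ((p + δ).2 : ℂ) * I)).im)) *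
      starRingEnd ℂ ((pwt x R u ((p.1 : ℂ) + (p.2 : ℂ) * I) : ℂ) * VdC.e ((logPhase w u ((p.1 : ℂ) + (p.2 : ℂ) * I)).im))
    = (pwtH x R u ((δ.1 : ℂ) + (δ.2 : ℂ) * I) ((p.1 : ℂ) + (p.2 : ℂ) * I) : ℂ) *
        VdC.e ((shiftPhase w u ((δ.1 : ℂ) + (δ.2 : ℂ) * I) ((p.1 : ℂ) + (p.2 : ℂ) * I)).im) := by
  have hz : (((p + δ).1 : ℂ) + ((p + δ).2 : ℂ) * I) = ((p.1 : ℂ) + (p.2 : ℂ) * I) + ((δ.1 : ℂ) + (δ.2 : ℂ) * I) := by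
    simp only [Prod.fst_add, Prod.snd_add]; push_cast; ring
  rw [hz, map_mul, Complex.conj_ofReal, ← e_neg, pwtH, shiftPhase, Complex.sub_im, sub_eq_add_neg, e_add]
  push_cast
  ring

set_option maxHeartbeats 1600000 in
/-- **The differenced piece bound in lattice form** (`R ≥ 10¹⁵`, `R² ≤ x`, `W = ‖w‖/2π = t³`, `600t ≤ R ≤ t²`):
`‖∑_z φ_T(z) e(F_u(z))‖ ≤ 1.4·10¹⁴ C_S (log(1+W)+4)^{1/2} W^{1/3}`, by the two-dimensional Weyl differencing
`VdC.vanDerCorput_ineq_2d` with `H ≍ R W^{-1/3}` and `VdC.norm_diffPiece_le` for every nonzero shift.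
[cite: Titchmarsh1935Lattice] [cite: Kaufman1979] -/
theorem norm_piece_diff {w u : ℂ} {R x t : ℝ} (hu : ‖u‖ = 1) (hw : w ≠ 0) (hR : (10 : ℝ) ^ 15 ≤ R) (hx : R ^ 2 ≤ x)
    (ht : 1 ≤ t) (hWt : ‖w‖ / (2 * π) = t ^ 3) (hRlo : 600 * t ≤ R) (hRhi : R ≤ t ^ 2) :
    ‖∑ z ∈ lattZ ⌊x⌋₊, (pwt x R u z : ℂ) * VdC.e ((logPhase w u z).im)‖
      ≤ 14 * 10 ^ 13 * stepC * Real.sqrt (Real.log (1 + t ^ 3) + 4) * t := by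
  classical
  have hC := one_le_stepC
  have hR1' : 1 ≤ R := le_trans (by norm_num) hR
  have hR0 : 0 < R := by linarith
  have hR1 : 0 < R := hR0
  have ht0 : 0 < t := by linarith
  set X : ℕ := ⌊x⌋₊ with hX
  set N : ℤ := ⌈3 * R⌉ with hN
  -- the differencing parameter
  set Hr : ℝ := R / (300 * t) with hHr
  have hHr2 : 2 ≤ Hr := by rw [hHr, le_div_iff₀ (by positivity)]; linarith
  set H : ℕ := ⌊Hr⌋₊ with hHdef
  have hHle : (H : ℝ) ≤ Hr := Nat.floor_le (by linarith)
  have hHge : Hr - 1 ≤ H := by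
    have := Nat.lt_floor_add_one Hr; rw [← hHdef] at this; linarith
  have hH1 : 1 ≤ H := by
    have : (1 : ℝ) ≤ H := by linarith
    exact_mod_cast this
  have hH0 : (0 : ℝ) < H := by exact_mod_cast hH1
  have hHge' : R / (600 * t) ≤ H := by
    have : R / (600 * t) = Hr / 2 := by rw [hHr]; field_simp; ring
    rw [this]; linarith
  have hHR : (H : ℝ) ≤ R / 300 := hHle.trans (by
    rw [hHr]; exact div_le_div_of_nonneg_left hR0.le (by norm_num) (by nlinarith))
  -- the summand on `ℤ²`
  set c : ℤ × ℤ → ℂ := fun p => (pwt x R u ((p.1 : ℂ) + (p.2 : ℂ) * I) : ℂ) *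
    VdC.e ((logPhase w u ((p.1 : ℂ) + (p.2 : ℂ) * I)).im) with hc
  have hcast : ∀ p : ℤ × ℤ, (((⟨p.1, p.2⟩ : GaussianInt)) : ℂ) = (p.1 : ℂ) + (p.2 : ℂ) * I := fun p =>
    GaussianInt.toComplex_def' _ _
  have hcne : ∀ p : ℤ × ℤ, c p ≠ 0 → pwt x R u (((⟨p.1, p.2⟩ : GaussianInt)) : ℂ) ≠ 0 := by
    intro p hp h
    apply hp
    rw [hc]; dsimp only; rw [← hcast, h]; simp
  have hsupp : ∀ p : ℤ × ℤ, c p ≠ 0 → p ∈ Finset.Ioc (-N) N ×ˢ Finset.Ioc (-N) N := by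
    intro p hp
    obtain ⟨-, h1, h2, -⟩ := pwt_support_latt hu hR1 hx (hcne p hp)
    simp only at h1 h2
    rw [abs_lt] at h1 h2
    rw [Finset.mem_product, Finset.mem_Ioc, Finset.mem_Ioc]
    exact ⟨⟨h1.1, h1.2.le⟩, ⟨h2.1, h2.2.le⟩⟩
  have hc0 : ∀ p, p ∉ Finset.Ioc (-N) N ×ˢ Finset.Ioc (-N) N → c p = 0 := fun p hp => by
    by_contra h; exact hp (hsupp p h)
  -- the sum over the box is the lattice sum
  have hS : ∑ p ∈ Finset.Ioc (-N) N ×ˢ Finset.Ioc (-N) N, c p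
      = ∑ z ∈ lattZ X, (pwt x R u z : ℂ) * VdC.e ((logPhase w u z).im) := by
    have := sum_box_eq_sum_lattZ (X := X) (N := N)
      (F := fun z : GaussianInt => (pwt x R u z : ℂ) * VdC.e ((logPhase w u z).im)) (fun z hz => by
        have hz' : pwt x R u z ≠ 0 := fun h => hz (by simp [h])
        obtain ⟨h1, h2, h3, -⟩ := pwt_support_latt hu hR1 hx hz'
        exact ⟨h1, h2, h3⟩)
    rw [← this]
    refine Finset.sum_congr rfl fun p _ => ?_
    rw [hc]; dsimp only; rw [hcast]
  -- ### the Weyl–van der Corput inequality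
  have hNN : -N ≤ N := by
    have : (0 : ℝ) ≤ N := le_trans (by positivity) (Int.le_ceil (3 * R)); have h' : (0 : ℤ) ≤ N := by exact_mod_cast this
    omega
  have hV := vanDerCorput_ineq_2d hc0 hNN hNN hH1
  rw [hS] at hV
  set S := ‖∑ z ∈ lattZ X, (pwt x R u z : ℂ) * VdC.e ((logPhase w u z).im)‖ with hSdef
  -- ### the correlation at the zero shift
  have hcorr0 : ‖corr2 c (-N) N (-N) N 0‖ ≤ 1320 := by
    rw [corr2]
    refine (norm_sum_le _ _).trans ?_
    have hterm : ∀ p ∈ Finset.Ioc (-N) N ×ˢ Finset.Ioc (-N) N,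
        ‖c (p + 0) * starRingEnd ℂ (c p)‖ ≤ |pwt x R u (((⟨p.1, p.2⟩ : GaussianInt)) : ℂ)| * (4 / R) := by
      intro p _
      rw [add_zero, norm_mul, Complex.norm_conj, hc]
      dsimp only
      rw [norm_mul, norm_e, mul_one, Complex.norm_real, Real.norm_eq_abs, hcast]
      by_cases h0 : pwt x R u ((p.1 : ℂ) + (p.2 : ℂ) * I) = 0
      · rw [h0]; simp
      · exact mul_le_mul_of_nonneg_left (pwt_support hu hR1 hx h0).2.2.2.2 (abs_nonneg _)
    refine (Finset.sum_le_sum hterm).trans ?_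
    rw [← Finset.sum_mul]
    have hinj : Function.Injective (fun p : ℤ × ℤ => (⟨p.1, p.2⟩ : GaussianInt)) := by
      intro p q h
      have h1 := congrArg Zsqrtd.re h; have h2 := congrArg Zsqrtd.im h
      simp at h1 h2
      exact Prod.ext h1 h2
    have := sum_abs_pwt_le hu hR1 hx (u := u) ((Finset.Ioc (-N) N ×ˢ Finset.Ioc (-N) N).image fun p : ℤ × ℤ => (⟨p.1, p.2⟩ : GaussianInt))
    rw [Finset.sum_image hinj.injOn] at this
    calc (∑ p ∈ Finset.Ioc (-N) N ×ˢ Finset.Ioc (-N) N, |pwt x R u (((⟨p.1, p.2⟩ : GaussianInt)) : ℂ)|) * (4 / R)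
        ≤ (288 * R + 36 / R) * (4 / R) := mul_le_mul_of_nonneg_right this (by positivity)
      _ = 1152 + 144 / R ^ 2 := by field_simp; ring
      _ ≤ 1320 := by
          have : 144 / R ^ 2 ≤ 144 := by
            rw [div_le_iff₀ (by positivity)]; nlinarith
          linarith
  -- ### the correlations at nonzero shifts
  set LW := Real.log (1 + t ^ 3) + 4 with hLW
  have hLW4 : 4 ≤ LW := by
    have : 0 ≤ Real.log (1 + t ^ 3) := Real.log_nonneg (by nlinarith [pow_pos ht0 3]); linarith
  set A₁ : ℝ := pieceK * stepC ^ 2 * LW * (16 / R) * (9 / 2 * H * t ^ 3 / R ^ 2 + 81 / 4 * (H : ℝ) ^ 2 * t ^ 6 / R ^ 5 + 1)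
    with hA₁
  set A₂ : ℝ := pieceK * stepC ^ 2 * LW * (16 * R / (3 * t ^ 3)) with hA₂
  have hK0 : (0 : ℝ) < pieceK := by rw [pieceK]; positivity
  have hA₁0 : 0 ≤ A₁ := by positivity
  have hA₂0 : 0 ≤ A₂ := by positivity
  have hcorr : ∀ δ ∈ (Finset.Ioo (-(H : ℤ)) H ×ˢ Finset.Ioo (-(H : ℤ)) H).filter (fun δ => δ ≠ 0),
      ‖corr2 c (-N) N (-N) N δ‖ ≤ A₁ + A₂ * (1 / linf δ) := by
    intro δ hδ
    rw [Finset.mem_filter] at hδ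
    obtain ⟨hlin1, hlin2, hlin3, hlin4⟩ := linf_facts δ
    have hr1 : 1 ≤ linf δ := hlin1 hδ.2
    have hrH : linf δ < H := hlin2 H hδ.1
    set h : ℂ := (δ.1 : ℂ) + (δ.2 : ℂ) * I with hh
    have hh0 : h ≠ 0 := by
      intro h0
      have : (linf δ : ℝ) ≤ 0 := by rw [h0, norm_zero] at hlin3; exact hlin3
      have : (1 : ℝ) ≤ linf δ := by exact_mod_cast hr1
      linarith
    have hnh : ‖h‖ ≤ 3 / 2 * H := hlin4.trans (by
      have : (linf δ : ℝ) ≤ H := by exact_mod_cast hrH.le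
      linarith)
    have hh200 : ‖h‖ ≤ R / 200 := hnh.trans (by linarith)
    -- the correlation is the differenced piece
    have hcorr_eq : corr2 c (-N) N (-N) N δ
        = ∑ z ∈ lattZ X, (pwtH x R u h z : ℂ) * VdC.e ((shiftPhase w u h z).im) := by
      rw [corr2]
      have h1 : ∀ p ∈ Finset.Ioc (-N) N ×ˢ Finset.Ioc (-N) N, c (p + δ) * starRingEnd ℂ (c p)
          = (fun z : GaussianInt => (pwtH x R u h z : ℂ) * VdC.e ((shiftPhase w u h z).im)) ⟨p.1, p.2⟩ := by
        intro p _
        dsimp only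
        rw [hcast, hc]
        exact corr_term_eq (w := w) (u := u) (R := R) (x := x) p δ
      rw [Finset.sum_congr rfl h1]
      refine sum_box_eq_sum_lattZ (X := X) (N := N)
        (F := fun z : GaussianInt => (pwtH x R u h z : ℂ) * VdC.e ((shiftPhase w u h z).im)) (fun z hz => ?_)
      have hz' : pwt x R u z ≠ 0 := by
        intro h0; apply hz; rw [pwtH, h0, mul_zero]; simp
      obtain ⟨ha, hb, hc', -⟩ := pwt_support_latt hu hR1 hx hz'
      exact ⟨ha, hb, hc'⟩
    rw [hcorr_eq]
    obtain ⟨k, hk⟩ := norm_diffPiece_le (x := x) hu hw hR hx hh0 hh200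
    rw [sum_lattZ_eq_lines hu hR1 hx k (φ := pwtH x R u h)
      (fun z hz => by intro h0; apply hz; rw [pwtH, h0, mul_zero]) (fun z => (shiftPhase w u h z).im)]
    refine hk.trans ?_
    rw [hWt]
    have hrn : (linf δ : ℝ) ≤ ‖h‖ := hlin3
    exact diffB_le hC ht hR1' (by exact_mod_cast hr1) hrn hnh (by rw [← hHr]; exact hHle) hH0
  -- ### sum over the shifts
  have hsumδ : ∑ δ ∈ Finset.Ioo (-(H : ℤ)) H ×ˢ Finset.Ioo (-(H : ℤ)) H, ‖corr2 c (-N) N (-N) N δ‖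
      ≤ 1320 + 4 * (H : ℝ) ^ 2 * A₁ + 12 * H * A₂ := by
    set D := Finset.Ioo (-(H : ℤ)) H ×ˢ Finset.Ioo (-(H : ℤ)) H with hD
    have h0mem : (0 : ℤ × ℤ) ∈ D := by
      rw [hD, Finset.mem_product, Finset.mem_Ioo, Finset.mem_Ioo]
      simp only [Prod.fst_zero, Prod.snd_zero]
      omega
    rw [← Finset.sum_filter_add_sum_filter_not D (fun δ => δ = 0)]
    have hfilt : D.filter (fun δ => δ = 0) = {0} := by
      ext δ; simp only [Finset.mem_filter, Finset.mem_singleton]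
      exact ⟨fun h => h.2, fun h => ⟨h ▸ h0mem, h⟩⟩
    rw [hfilt, Finset.sum_singleton]
    have h2 : ∑ δ ∈ D.filter (fun δ => ¬δ = 0), ‖corr2 c (-N) N (-N) N δ‖
        ≤ ∑ δ ∈ D.filter (fun δ => ¬δ = 0), (A₁ + A₂ * (1 / linf δ)) :=
      Finset.sum_le_sum fun δ hδ => hcorr δ (by simpa using hδ)
    have h3 : ∑ δ ∈ D.filter (fun δ => ¬δ = 0), (A₁ + A₂ * (1 / (linf δ : ℝ)))
        = (D.filter (fun δ => ¬δ = 0)).card * A₁ + A₂ * ∑ δ ∈ D.filter (fun δ => ¬δ = 0), (1 / (linf δ : ℝ)) := by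
      rw [Finset.sum_add_distrib, Finset.sum_const, nsmul_eq_mul, Finset.mul_sum]
    have h4 : ((D.filter (fun δ => ¬δ = 0)).card : ℝ) ≤ 4 * (H : ℝ) ^ 2 := by
      have := card_shifts_le H; simpa [hD] using this
    have h5 : ∑ δ ∈ D.filter (fun δ => ¬δ = 0), (1 / (linf δ : ℝ)) ≤ 12 * H := by
      have := sum_inv_linf_le H; simpa [hD] using this
    have h6 : ((D.filter (fun δ => ¬δ = 0)).card : ℝ) * A₁ ≤ 4 * (H : ℝ) ^ 2 * A₁ :=
      mul_le_mul_of_nonneg_right h4 hA₁0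
    have h7 : A₂ * ∑ δ ∈ D.filter (fun δ => ¬δ = 0), (1 / (linf δ : ℝ)) ≤ A₂ * (12 * H) :=
      mul_le_mul_of_nonneg_left h5 hA₂0
    linarith [hcorr0, h2, h3, h6, h7]
  -- ### combine
  have hside : ((N : ℝ) - (-N : ℤ) + H) * ((N : ℝ) - (-N : ℤ) + H) ≤ (7 * R) ^ 2 := by
    have hN1 : (N : ℝ) < 3 * R + 1 := Int.ceil_lt_add_one _
    have hN0 : (0 : ℝ) ≤ (N : ℝ) - (-N : ℤ) + H := by push_cast; linarith [Int.le_ceil (3 * R)]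
    have h7 : (N : ℝ) - (-N : ℤ) + H ≤ 7 * R := by push_cast; linarith
    nlinarith
  have hmain : (H : ℝ) ^ 2 * S ^ 2 ≤ (7 * R) ^ 2 * (1320 + 4 * (H : ℝ) ^ 2 * A₁ + 12 * H * A₂) := by
    refine hV.trans ?_
    refine mul_le_mul hside hsumδ (Finset.sum_nonneg fun δ _ => norm_nonneg _) (by positivity)
  exact diff_arith ht hRlo hRhi hHge' (by rw [← hHr]; exact hHle) hC hLW4 (norm_nonneg _) hmain


end VdC

/-! ### The Weyl-type bound and Ricci's zero-density theorem -/

namespace GaussianHecke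

open VdC GaussianInt GaussianTheta

/-- The size of `w = 4m - 2τ i`: `w ≠ 0` and `V/7 ≤ ‖w‖/2π ≤ V` for `V = m + |τ| + 2 ≥ 10`. [folklore] -/
theorem w_bounds {m : ℕ} (hm : m ≠ 0) (τ : ℝ) {V : ℝ} (hV : V = (m : ℝ) + |τ| + 2) (hV10 : 10 ≤ V) :
    (4 * (m : ℂ) - 2 * τ * I) ≠ 0 ∧ V / 7 ≤ ‖4 * (m : ℂ) - 2 * τ * I‖ / (2 * π) ∧ ‖4 * (m : ℂ) - 2 * τ * I‖ / (2 * π) ≤ V := by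
  have hπ := Real.pi_gt_d2
  have hπ' := Real.pi_lt_d2
  have hm1 : (1 : ℝ) ≤ m := by exact_mod_cast Nat.one_le_iff_ne_zero.2 hm
  have hn : ‖4 * (m : ℂ) - 2 * τ * I‖ ^ 2 = 16 * (m : ℝ) ^ 2 + 4 * τ ^ 2 := by
    rw [Complex.sq_norm, Complex.normSq_apply]; simp; ring
  have h0 : 0 ≤ ‖4 * (m : ℂ) - 2 * τ * I‖ := norm_nonneg _
  have hτ := abs_nonneg τ
  have hlo : 2 * (m : ℝ) + |τ| ≤ ‖4 * (m : ℂ) - 2 * τ * I‖ :=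
    (pow_le_pow_iff_left₀ (by positivity) h0 two_ne_zero).1 (by
      rw [hn]; nlinarith [sq_abs τ, sq_nonneg (2 * (m : ℝ) - |τ|)])
  have hhi : ‖4 * (m : ℂ) - 2 * τ * I‖ ≤ 4 * (m : ℝ) + 2 * |τ| :=
    (pow_le_pow_iff_left₀ h0 (by positivity) two_ne_zero).1 (by
      rw [hn]; nlinarith [sq_abs τ])
  refine ⟨fun h => ?_, ?_, ?_⟩
  · have := congrArg Complex.re h; simp at this; exact hm (by exact_mod_cast this)
  · rw [div_le_div_iff₀ (by norm_num) (by positivity)]; rw [hV] at hV10 ⊢; nlinarith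
  · rw [div_le_iff₀ (by positivity)]; rw [hV]; nlinarith

set_option maxHeartbeats 800000 in
/-- **The bound for every piece**: for `V = m + |τ| + 2 ≥ 100`, `x = V^{5/2}`, and every piece `(j, s)` with
`R_j² ≤ x`, `‖∑_{z} φ_{T_{j,s}}(z) e(F_{u_s}(z))‖ ≤ 120 K C_S² V^{1/3} log V`. [cite: Kaufman1979] -/
theorem piece_bound {m : ℕ} (hm : m ≠ 0) (τ : ℝ) {V x : ℝ} (hV : V = (m : ℝ) + |τ| + 2) (hV100 : 100 ≤ V)
    (hx : x = V ^ (5 / 2 : ℝ)) (j s : ℕ) (hj : Rj j ^ 2 ≤ x) :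
    ‖∑ z ∈ lattZ ⌊x⌋₊, (pwt x (Rj j) (uDir s) z : ℂ) *
        VdC.e ((logPhase (4 * (m : ℂ) - 2 * τ * I) (uDir s) z).im)‖
      ≤ 120 * pieceK * stepC ^ 2 * V ^ (1 / 3 : ℝ) * Real.log V := by
  have hC := one_le_stepC
  have hV1 : 1 ≤ V := by linarith
  have hV0 : 0 < V := by linarith
  obtain ⟨hw, hWlo, hWhi⟩ := w_bounds hm τ hV (by linarith)
  set w : ℂ := 4 * (m : ℂ) - 2 * τ * I with hwdef
  set W : ℝ := ‖w‖ / (2 * π) with hWdef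
  have hW1 : 1 ≤ W := by linarith
  have hW0 : 0 < W := by linarith
  set t : ℝ := W ^ (1 / 3 : ℝ) with htdef
  have ht1 : 1 ≤ t := Real.one_le_rpow hW1 (by norm_num)
  have ht0 : 0 < t := by linarith
  have ht3 : t ^ 3 = W := by
    rw [htdef, ← Real.rpow_natCast, ← Real.rpow_mul hW0.le]; norm_num
  have htV : t ≤ V ^ (1 / 3 : ℝ) := Real.rpow_le_rpow hW0.le hWhi (by norm_num)
  have hV3 : 1 ≤ V ^ (1 / 3 : ℝ) := Real.one_le_rpow hV1 (by norm_num)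
  set R := Rj j with hRdef
  obtain ⟨hRsq, hR0⟩ := Rj_sq j
  have hR12 : 1 / 2 ≤ R := by
    have : (1 : ℝ) ≤ 2 ^ j := one_le_pow₀ (by norm_num)
    nlinarith
  -- logarithms
  have hlogV : 4 ≤ Real.log V := by
    have hexp : Real.exp 4 ≤ 100 := by
      have := Real.exp_one_lt_d9
      have h4 : Real.exp 4 = Real.exp 1 ^ 4 := by rw [← Real.exp_nat_mul]; norm_num
      rw [h4]
      have h1 : Real.exp 1 < 2.7182818286 := this
      have h2 : 0 < Real.exp 1 := Real.exp_pos 1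
      have h3 : Real.exp 1 ^ 2 < 2.7182818286 ^ 2 := by nlinarith
      nlinarith
    calc (4 : ℝ) = Real.log (Real.exp 4) := (Real.log_exp 4).symm
      _ ≤ Real.log V := Real.log_le_log (Real.exp_pos 4) (by linarith)
  set LW := Real.log (1 + W) + 4 with hLW
  have hLW4 : 4 ≤ LW := by have : 0 ≤ Real.log (1 + W) := Real.log_nonneg (by linarith); linarith
  have hLWle : LW ≤ 3 * Real.log V := by
    have h1 : Real.log (1 + W) ≤ Real.log 2 + Real.log V := by
      rw [← Real.log_mul (by norm_num) hV0.ne']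
      exact Real.log_le_log (by linarith) (by linarith)
    have h2 : Real.log 2 ≤ 1 := by
      have := Real.log_two_lt_d9; linarith
    linarith
  -- the target in convenient form
  have htarget : ∀ B : ℝ, B ≤ 4 * pieceK * stepC ^ 2 * LW * (t + 2 + 7 * V ^ (1 / 3 : ℝ)) →
      B ≤ 120 * pieceK * stepC ^ 2 * V ^ (1 / 3 : ℝ) * Real.log V := by
    intro B hB
    refine hB.trans ?_
    have hK0 : (0 : ℝ) < pieceK := by rw [pieceK]; positivity
    have h1 : t + 2 + 7 * V ^ (1 / 3 : ℝ) ≤ 10 * V ^ (1 / 3 : ℝ) := by linarith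
    have h0 : 0 ≤ 4 * pieceK * stepC ^ 2 := by positivity
    calc 4 * pieceK * stepC ^ 2 * LW * (t + 2 + 7 * V ^ (1 / 3 : ℝ))
        ≤ 4 * pieceK * stepC ^ 2 * (3 * Real.log V) * (10 * V ^ (1 / 3 : ℝ)) := by
          refine mul_le_mul (mul_le_mul_of_nonneg_left hLWle h0) h1 (by positivity) (by positivity)
      _ = 120 * pieceK * stepC ^ 2 * V ^ (1 / 3 : ℝ) * Real.log V := by ring
  have hK0 : (0 : ℝ) < pieceK := by rw [pieceK]; positivity
  have hK22 : pieceK = 10 ^ 22 := by rw [pieceK]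
  have hbig : 4 * 10 ^ 22 ≤ 4 * pieceK * stepC ^ 2 * LW := by
    rw [hK22]; nlinarith
  have hu : ‖uDir s‖ = 1 := norm_uDir s
  -- ### the three regimes
  by_cases hA : (10 : ℝ) ^ 15 ≤ R ∧ 600 * t ≤ R
  · by_cases hB : R ≤ t ^ 2
    · -- differencing
      have h := norm_piece_diff (x := x) hu hw hA.1 hj ht1 (by rw [ht3]) hA.2 hB
      refine htarget _ (h.trans ?_)
      rw [ht3, ← hLW]
      have hsq : Real.sqrt LW ≤ LW := by
        rw [Real.sqrt_le_left (by linarith)]; nlinarith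
      have h1 : 14 * 10 ^ 13 * stepC * Real.sqrt LW * t ≤ 14 * 10 ^ 13 * stepC ^ 2 * LW * t := by
        have : stepC * Real.sqrt LW ≤ stepC ^ 2 * LW :=
          mul_le_mul (by nlinarith) hsq (Real.sqrt_nonneg _) (by positivity)
        have := mul_le_mul_of_nonneg_right this ht0.le
        nlinarith
      have h2 : 14 * 10 ^ 13 * stepC ^ 2 * LW * t ≤ 4 * pieceK * stepC ^ 2 * LW * t := by
        refine mul_le_mul_of_nonneg_right ?_ ht0.le
        rw [hK22]; nlinarith [mul_nonneg (by positivity : (0:ℝ) ≤ stepC ^ 2) (by linarith : (0:ℝ) ≤ LW)]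
      have h3 : 4 * pieceK * stepC ^ 2 * LW * t ≤ 4 * pieceK * stepC ^ 2 * LW * (t + 2 + 7 * V ^ (1 / 3 : ℝ)) :=
        mul_le_mul_of_nonneg_left (by linarith) (by positivity)
      linarith
    · -- plain
      push Not at hB
      have hR10 : (10 : ℝ) ^ 10 ≤ R := le_trans (by norm_num) hA.1
      have h := norm_piece_plain (x := x) hu hw hR10 hj
      refine htarget _ (h.trans ?_)
      rw [← hWdef, ← hLW]
      -- `W/R + W²/R³ + 1 + R/W ≤ t + 2 + 7 V^{1/3}`
      have hRt : t ^ 2 < R := hB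
      have hR0' : 0 < R := hR0
      have b1 : W / R ≤ t := by
        rw [div_le_iff₀ hR0', ← ht3]; nlinarith [pow_pos ht0 2]
      have b2 : W ^ 2 / R ^ 3 ≤ 1 := by
        rw [div_le_one (by positivity), ← ht3]
        have : (t ^ 2) ^ 3 ≤ R ^ 3 := pow_le_pow_left₀ (by positivity) hRt.le 3
        nlinarith
      have b3 : R / W ≤ 7 * V ^ (1 / 3 : ℝ) := by
        have hRx : R ≤ Real.sqrt x := by
          rw [show R = Real.sqrt (R ^ 2) by rw [Real.sqrt_sq hR0.le]]; exact Real.sqrt_le_sqrt hj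
        have hsx : Real.sqrt x = V ^ (5 / 4 : ℝ) := by
          rw [hx, Real.sqrt_eq_rpow, ← Real.rpow_mul hV0.le]; norm_num
        have hV14 : V ^ (5 / 4 : ℝ) = V * V ^ (1 / 4 : ℝ) := by
          rw [show (5 / 4 : ℝ) = 1 + 1 / 4 by norm_num, Real.rpow_add hV0, Real.rpow_one]
        have hV13 : V ^ (1 / 4 : ℝ) ≤ V ^ (1 / 3 : ℝ) := Real.rpow_le_rpow_of_exponent_le hV1 (by norm_num)
        rw [div_le_iff₀ hW0]
        calc R ≤ V * V ^ (1 / 4 : ℝ) := by rw [← hV14, ← hsx]; exact hRx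
          _ ≤ (7 * W) * V ^ (1 / 3 : ℝ) := mul_le_mul (by linarith) hV13 (by positivity) (by positivity)
          _ = 7 * V ^ (1 / 3 : ℝ) * W := by ring
      have : W / R + W ^ 2 / R ^ 3 + 1 + R / W ≤ t + 2 + 7 * V ^ (1 / 3 : ℝ) := by linarith
      have h0 : 0 ≤ pieceK * stepC ^ 2 * LW * 4 := by positivity
      calc pieceK * stepC ^ 2 * LW * 4 * (W / R + W ^ 2 / R ^ 3 + 1 + R / W)
          ≤ pieceK * stepC ^ 2 * LW * 4 * (t + 2 + 7 * V ^ (1 / 3 : ℝ)) := mul_le_mul_of_nonneg_left this h0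
        _ = 4 * pieceK * stepC ^ 2 * LW * (t + 2 + 7 * V ^ (1 / 3 : ℝ)) := by ring
  · -- trivial
    have h := norm_piece_trivial (x := x) hu hR0 hj (lattZ ⌊x⌋₊) (fun z => (logPhase w (uDir s) z).im)
    refine htarget _ (h.trans ?_)
    have hRlt : R < 10 ^ 15 * (600 * t) := by
      rw [not_and_or, not_le, not_le] at hA
      rcases hA with h' | h'
      · calc R < 10 ^ 15 := h'
          _ ≤ 10 ^ 15 * (600 * t) := by nlinarith
      · calc R < 600 * t := h'
          _ ≤ 10 ^ 15 * (600 * t) := by nlinarith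
    have h36 : 36 / R ≤ 72 := by rw [div_le_iff₀ hR0]; linarith
    have h1 : 288 * R + 36 / R ≤ 2 * 10 ^ 20 * t := by nlinarith
    have h2 : 2 * 10 ^ 20 * t ≤ 4 * pieceK * stepC ^ 2 * LW * t := by
      refine mul_le_mul_of_nonneg_right ?_ ht0.le; linarith
    have h3 : 4 * pieceK * stepC ^ 2 * LW * t ≤ 4 * pieceK * stepC ^ 2 * LW * (t + 2 + 7 * V ^ (1 / 3 : ℝ)) :=
      mul_le_mul_of_nonneg_left (by linarith) (by positivity)
    linarith

/-- `log 3 ≥ 1` (private copy; the tree's public one, `Literature.NumberTheory.Sieve.BetaSieve.one_le_log_three`,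
lives in an unrelated sieve file which we do not import). [folklore] -/
private theorem one_le_log_three : (1 : ℝ) ≤ Real.log 3 := by
  rw [← Real.log_exp 1]
  refine Real.log_le_log (Real.exp_pos 1) ?_
  have := Real.exp_one_lt_d9; linarith

set_option maxHeartbeats 3200000 in
/-- **The Weyl-type bound on the critical line** (Kaufman 1979): there are `A ≥ 1` and `c` (here `c = 2`) with
`‖D_m(1/2 + iτ)‖ ≤ A (m + |τ| + 2)^{1/3} log^c (m + |τ| + 2)` for all `m ≥ 1`, `τ ∈ ℝ`. [cite: Kaufman1979] -/
theorem weyl_pointwise : ∃ (A : ℝ) (c : ℕ), 1 ≤ A ∧ ∀ m : ℕ, m ≠ 0 → ∀ τ : ℝ,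
    ‖heckeL m (1 / 2 + τ * I)‖ ≤ A * ((m : ℝ) + |τ| + 2) ^ (1 / 3 : ℝ) * Real.log ((m : ℝ) + |τ| + 2) ^ c := by
  -- the convexity constant
  set D₀ : ℝ := ∑' x : GaussianInt, ((x.norm : ℤ) : ℝ) ^ (-(3 / 2 : ℝ)) with hD₀def
  have hD₀ : 0 < D₀ := normSum_pos (by norm_num)
  have hC := one_le_stepC
  have hK0 : (0 : ℝ) < pieceK := by rw [pieceK]; positivity
  refine ⟨28800 * pieceK * stepC ^ 2 + 90000 * D₀ + 1, 2, by nlinarith [mul_pos hK0 (by positivity : (0:ℝ) < stepC ^ 2)], fun m hm τ ↦ ?_⟩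
  set A : ℝ := 28800 * pieceK * stepC ^ 2 + 90000 * D₀ + 1 with hAdef
  have hm1 : (1 : ℝ) ≤ m := by exact_mod_cast Nat.one_le_iff_ne_zero.2 hm
  -- ### the parameters
  set V : ℝ := (m : ℝ) + |τ| + 2 with hVdef
  have hV3 : 3 ≤ V := by rw [hVdef]; linarith [abs_nonneg τ]
  have hV1 : 1 ≤ V := by linarith
  have hV0 : 0 < V := by linarith
  have hlog1 : 1 ≤ Real.log V := one_le_log_three.trans (Real.log_le_log (by norm_num) hV3)
  have hV13 : 1 ≤ V ^ (1 / 3 : ℝ) := Real.one_le_rpow hV1 (by norm_num)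
  have hbase : 1 ≤ V ^ (1 / 3 : ℝ) * Real.log V ^ 2 := by nlinarith
  have hA1 : 90000 * D₀ ≤ A := by rw [hAdef]; nlinarith [mul_pos hK0 (by positivity : (0:ℝ) < stepC ^ 2)]
  -- ### small `V`: convexity bound
  by_cases hV100 : V ≤ 100
  · have hb := norm_heckeL_le_mul_sq' hm (z := 1 / 2 + τ * I) (by simp; norm_num) (by simp; norm_num)
    simp only [Complex.add_im, Complex.mul_im, Complex.ofReal_re, Complex.I_im, Complex.ofReal_im, Complex.I_re,
      mul_one, mul_zero, add_zero] at hb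
    have him : ((1 : ℂ) / 2).im = 0 := by simp
    rw [him, zero_add] at hb
    have h1 : (|τ| + 2 * m + 4) ^ 2 ≤ 4 * V ^ 2 := by rw [hVdef]; nlinarith [abs_nonneg τ]
    calc ‖heckeL m (1 / 2 + τ * I)‖ ≤ D₀ * (|τ| + 2 * m + 4) ^ 2 := hb
      _ ≤ D₀ * (4 * 100 ^ 2) := by
          refine mul_le_mul_of_nonneg_left (h1.trans ?_) hD₀.le; nlinarith
      _ ≤ A * 1 := by linarith
      _ ≤ A * (V ^ (1 / 3 : ℝ) * Real.log V ^ 2) := mul_le_mul_of_nonneg_left hbase (by linarith)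
      _ = A * V ^ (1 / 3 : ℝ) * Real.log V ^ 2 := by ring
  push Not at hV100
  -- ### large `V`
  have hlog4 : 4 ≤ Real.log V := by
    have hexp : Real.exp 4 ≤ 100 := by
      have := Real.exp_one_lt_d9
      have h4 : Real.exp 4 = Real.exp 1 ^ 4 := by rw [← Real.exp_nat_mul]; norm_num
      rw [h4]
      have h1 : Real.exp 1 < 2.7182818286 := this
      have h2 : 0 < Real.exp 1 := Real.exp_pos 1
      have h3 : Real.exp 1 ^ 2 < 2.7182818286 ^ 2 := by nlinarith
      nlinarith
    calc (4 : ℝ) = Real.log (Real.exp 4) := (Real.log_exp 4).symm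
      _ ≤ Real.log V := Real.log_le_log (Real.exp_pos 4) (by linarith)
  set σ : ℝ := 1 / 2 with hσdef
  set x : ℝ := V ^ (5 / 2 : ℝ) with hxdef
  have hx1 : 1 ≤ x := by rw [hxdef]; exact Real.one_le_rpow hV1 (by norm_num)
  have hx0 : 0 < x := by linarith
  set s₀ : ℂ := (σ : ℂ) + τ * I with hs₀def
  have hs₀ : s₀ = 1 / 2 + τ * I := by rw [hs₀def, hσdef]; push_cast; ring
  -- ### the continued function and its bound
  set Φ : ℂ → ℂ := fun u ↦ heckeL m (s₀ + u) with hΦdef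
  have hΦd : Differentiable ℂ Φ := (differentiable_heckeL hm).comp (differentiable_id.const_add s₀)
  set K₁ : ℝ := |τ| + 2 * m + 4 with hK₁def
  have hK₁1 : 1 ≤ K₁ := by rw [hK₁def]; linarith [abs_nonneg τ]
  have hK₁V : K₁ ≤ 2 * V := by rw [hK₁def, hVdef]; linarith [abs_nonneg τ]
  have hbound : ∀ u : ℂ, -3 / 4 ≤ u.re → u.re ≤ 1 → ‖Φ u‖ ≤ D₀ * (K₁ + |u.im|) ^ 2 := by
    intro u hu1 hu2
    have hre : (s₀ + u).re = σ + u.re := by simp [hs₀def]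
    have him : (s₀ + u).im = τ + u.im := by simp [hs₀def]
    have h1 : -1 / 2 ≤ (s₀ + u).re := by rw [hre, hσdef]; linarith
    have h2 : (s₀ + u).re ≤ 3 := by rw [hre, hσdef]; linarith
    have hb := norm_heckeL_le_mul_sq' hm h1 h2
    rw [him] at hb
    refine hb.trans (mul_le_mul_of_nonneg_left ?_ hD₀.le)
    have habs : |τ + u.im| ≤ |τ| + |u.im| := abs_add_le _ _
    have h0 : 0 ≤ |τ + u.im| + 2 * m + 4 := by positivity
    apply pow_le_pow_left₀ h0
    rw [hK₁def]; linarith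
  -- ### the coefficients `f(n) = c_m(n) n^{-s₀}`
  set f : ℕ → ℂ := fun n ↦ cCoeff m n / (n : ℂ) ^ s₀ with hfdef
  have hterm : ∀ (u : ℂ) (n : ℕ), LSeries.term f u n = LSeries.term (cCoeff m) (s₀ + u) n := by
    intro u n
    rcases eq_or_ne n 0 with rfl | hn
    · simp [LSeries.term_zero]
    · rw [LSeries.term_of_ne_zero hn, LSeries.term_of_ne_zero hn, hfdef]
      dsimp only
      rw [div_div, ← cpow_add _ _ (Nat.cast_ne_zero.2 hn)]
  have hσc : 1 < σ + 1 := by rw [hσdef]; norm_num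
  have hsum : LSeriesSummable f 1 := by
    have hs : 1 < (s₀ + 1).re := by norm_num [hs₀def, hσdef]
    have := LSeriesSummable_cCoeff m hs
    unfold LSeriesSummable at this ⊢
    exact this.congr fun n ↦ (hterm 1 n).symm
  have hL : ∀ y : ℝ, LSeries f (1 + y * I) = Φ (1 + y * I) := by
    intro y
    have hs : 1 < (s₀ + (1 + y * I)).re := by norm_num [hs₀def, hσdef]
    rw [hΦdef]; dsimp only
    rw [heckeL_eq_LSeries m hs, LSeries, LSeries]
    exact tsum_congr fun n ↦ hterm (1 + y * I) n
  -- ### Perron + shift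
  have hP := RieszPerron3.norm_apply_zero_le f hΦd one_pos hx1 hD₀.le hK₁1 hbound hsum hL
  have hΦ0 : Φ 0 = heckeL m (1 / 2 + τ * I) := by simp [hΦdef, hs₀]
  rw [hΦ0] at hP
  -- ### the error term
  have herr : 12288 * D₀ * K₁ ^ 2 * x ^ (-(3 / 4 : ℝ)) ≤ 49152 * D₀ * V ^ (1 / 3 : ℝ) := by
    have hx34 : x ^ (-(3 / 4 : ℝ)) = V ^ (-(15 / 8 : ℝ)) := by
      rw [hxdef, ← Real.rpow_mul hV0.le]; norm_num
    rw [hx34]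
    have hK2 : K₁ ^ 2 ≤ 4 * V ^ 2 := by nlinarith [hK₁V, hK₁1]
    have hV2 : V ^ 2 * V ^ (-(15 / 8 : ℝ)) = V ^ (1 / 8 : ℝ) := by
      rw [← Real.rpow_natCast V 2, ← Real.rpow_add hV0]; norm_num
    have hV18 : V ^ (1 / 8 : ℝ) ≤ V ^ (1 / 3 : ℝ) := Real.rpow_le_rpow_of_exponent_le hV1 (by norm_num)
    have hpos : 0 ≤ V ^ (-(15 / 8 : ℝ)) := Real.rpow_nonneg hV0.le _
    calc 12288 * D₀ * K₁ ^ 2 * V ^ (-(15 / 8 : ℝ)) ≤ 12288 * D₀ * (4 * V ^ 2) * V ^ (-(15 / 8 : ℝ)) := by gcongr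
      _ = 49152 * D₀ * (V ^ 2 * V ^ (-(15 / 8 : ℝ))) := by ring
      _ ≤ 49152 * D₀ * V ^ (1 / 3 : ℝ) := by rw [hV2]; gcongr
  -- ### the main sum: `x⁻³ ∑ f(n)(x−n)³ = ∑ c_m(n) n^{-iτ} w(n)`
  set X : ℕ := ⌊x⌋₊ with hXdef
  have hX1 : 1 ≤ X := by rw [hXdef]; exact Nat.le_floor (by simpa using hx1)
  have hXx : (X : ℝ) ≤ x := Nat.floor_le hx0.le
  set w : ℕ → ℝ := fun n ↦ (n : ℝ) ^ (-σ) * (max (1 - (n : ℝ) / x) 0) ^ 3 with hwdef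
  set g : ℕ → ℂ := fun n ↦ cCoeff m n * (n : ℂ) ^ (-(τ * I)) * ((w n : ℝ) : ℂ) with hgdef
  have hterms : ∀ n ∈ Finset.Ioc 0 X, f n * ((x : ℂ) - n) ^ 3 = (x : ℂ) ^ 3 * g n := by
    intro n hn
    rw [Finset.mem_Ioc] at hn
    have hn0 : n ≠ 0 := by omega
    have hnx : (n : ℝ) ≤ x := le_trans (by exact_mod_cast hn.2) hXx
    have hnpos : (0 : ℝ) < n := by exact_mod_cast hn.1
    have hmax : max (1 - (n : ℝ) / x) 0 = 1 - (n : ℝ) / x := max_eq_left (by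
      rw [sub_nonneg, div_le_one hx0]; exact hnx)
    have hnC : (n : ℂ) ≠ 0 := Nat.cast_ne_zero.2 hn0
    have hsplit : ((n : ℂ) ^ s₀)⁻¹ = (((n : ℝ) ^ (-σ) : ℝ) : ℂ) * (n : ℂ) ^ (-(τ * I)) := by
      rw [← cpow_neg, hs₀def, show -((σ : ℂ) + τ * I) = ((-σ : ℝ) : ℂ) + -(τ * I) by push_cast; ring,
        cpow_add _ _ hnC, Complex.ofReal_cpow hnpos.le]
      push_cast; ring
    rw [hgdef, hwdef, hfdef]; dsimp only
    rw [hmax, div_eq_mul_inv, hsplit]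
    have hxC : (x : ℂ) ≠ 0 := ofReal_ne_zero.2 hx0.ne'
    push_cast
    field_simp
  have hmain_eq : x ^ (-(3 : ℝ)) * ‖∑ n ∈ Finset.Ioc 0 X, f n * ((x : ℂ) - n) ^ 3‖ = ‖∑ n ∈ Finset.Ioc 0 X, g n‖ := by
    rw [Finset.sum_congr rfl hterms, ← Finset.mul_sum, norm_mul]
    have : ‖(x : ℂ) ^ 3‖ = x ^ (3 : ℝ) := by
      rw [norm_pow, Complex.norm_real, Real.norm_of_nonneg hx0.le, Real.rpow_ofNat]
    rw [this, ← mul_assoc, ← Real.rpow_add hx0]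
    norm_num
  rw [hmain_eq] at hP
  -- ### the lattice form of the main sum
  have hlatt : ∑ n ∈ Finset.Ioc 0 X, g n
      = ∑ z ∈ lattZ X, angularChar m z * (((z.norm : ℝ)) : ℂ) ^ (-(τ * I)) * ((gWt x z.norm : ℝ) : ℂ) := by
    have h1 : ∀ n, g n = cCoeff m n * ((n : ℂ) ^ (-(τ * I)) * ((w n : ℝ) : ℂ)) := fun n => by rw [hgdef]; dsimp only; ring
    simp_rw [h1]
    rw [sum_Ioc_cCoeff_mul m (fun n => (n : ℂ) ^ (-(τ * I)) * ((w n : ℝ) : ℂ)) X, lattZ]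
    refine Finset.sum_congr rfl fun z hz => ?_
    rw [Finset.mem_filter] at hz
    have h0 : 0 ≤ z.norm := GaussianInt.norm_nonneg z
    have hcastR : ((z.norm.natAbs : ℕ) : ℝ) = (z.norm : ℝ) := by
      rw [← Int.cast_natCast, Int.natAbs_of_nonneg h0]
    have hcast : ((z.norm.natAbs : ℕ) : ℂ) = (((z.norm : ℝ)) : ℂ) := by
      rw [← hcastR, Complex.ofReal_natCast]
    have hwg : ∀ n : ℕ, w n = gWt x n := fun n => by
      rw [hwdef]; dsimp only
      rw [gWt, rsq, rz, pp3, hσdef, show (1 : ℝ) - (n : ℝ) / x = -(1 / x) * (n : ℝ) + 1 by ring]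
    rw [hcast, mul_assoc, hwg, hcastR]
  -- ### the pieces
  set J : ℕ := Nat.log 2 X + 1 with hJdef
  have hJ1 : 2 ^ J ≤ 2 * X := by
    rw [hJdef, pow_succ]; have := Nat.pow_log_le_self 2 (by omega : X ≠ 0); omega
  have hXJ : (X : ℝ) ≤ 2 ^ J := by
    have : X < 2 ^ J := by rw [hJdef]; exact Nat.lt_pow_succ_log_self (by norm_num) X
    exact_mod_cast this.le
  have hpieces := latticeSum_eq_pieces m τ x (X := X) (J := J) hXJ
  rw [hlatt, hpieces] at hP
  -- each piece
  have hRj : ∀ j ∈ Finset.range (J + 1), Rj j ^ 2 ≤ x := by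
    intro j hj
    rw [Finset.mem_range] at hj
    rw [(Rj_sq j).1]
    have h1 : (2 : ℝ) ^ j ≤ 2 ^ J := pow_le_pow_right₀ (by norm_num) (by omega)
    have h2 : ((2 ^ J : ℕ) : ℝ) ≤ ((2 * X : ℕ) : ℝ) := by exact_mod_cast hJ1
    push_cast at h2
    linarith
  have hpiece : ∀ j ∈ Finset.range (J + 1), ∀ p ∈ Finset.range 2, ∀ k ∈ Finset.range 24,
      ‖uDir (2 * k + p) ^ (4 * m) * ∑ z ∈ lattZ X, (pwt x (Rj j) (uDir (2 * k + p)) z : ℂ) *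
          VdC.e ((logPhase (4 * m - 2 * τ * I) (uDir (2 * k + p)) z).im)‖
        ≤ 120 * pieceK * stepC ^ 2 * V ^ (1 / 3 : ℝ) * Real.log V := by
    intro j hj p _ k _
    rw [norm_mul, norm_pow, norm_uDir, one_pow, one_mul]
    exact piece_bound hm τ hVdef hV100.le hxdef j (2 * k + p) (hRj j hj)
  -- number of pieces
  have hJlog : ((J + 1 : ℕ) : ℝ) ≤ 5 * Real.log V := by
    have h2J : (2 : ℝ) ^ J ≤ 2 * x := by
      have h2 : ((2 ^ J : ℕ) : ℝ) ≤ ((2 * X : ℕ) : ℝ) := by exact_mod_cast hJ1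
      push_cast at h2; linarith
    have hl := Real.log_le_log (by positivity) h2J
    rw [Real.log_pow, Real.log_mul (by norm_num) hx0.ne', hxdef, Real.log_rpow hV0] at hl
    have hl2 := Real.log_two_gt_d9
    have hl2' := Real.log_two_lt_d9
    have hJ : (J : ℝ) * 0.6931471803 ≤ 0.6931471808 + 5 / 2 * Real.log V := by nlinarith [hlog1]
    push_cast
    nlinarith
  -- the main sum
  have hmain : ‖∑ j ∈ Finset.range (J + 1), ∑ p ∈ Finset.range 2, ∑ k ∈ Finset.range 24,
      uDir (2 * k + p) ^ (4 * m) * ∑ z ∈ lattZ X, (pwt x (Rj j) (uDir (2 * k + p)) z : ℂ) *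
        VdC.e ((logPhase (4 * m - 2 * τ * I) (uDir (2 * k + p)) z).im)‖
      ≤ 28800 * pieceK * stepC ^ 2 * V ^ (1 / 3 : ℝ) * Real.log V ^ 2 := by
    set B := 120 * pieceK * stepC ^ 2 * V ^ (1 / 3 : ℝ) * Real.log V with hB
    have hB0 : 0 ≤ B := by positivity
    calc _ ≤ ∑ j ∈ Finset.range (J + 1), ‖∑ p ∈ Finset.range 2, ∑ k ∈ Finset.range 24,
          uDir (2 * k + p) ^ (4 * m) * ∑ z ∈ lattZ X, (pwt x (Rj j) (uDir (2 * k + p)) z : ℂ) *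
            VdC.e ((logPhase (4 * m - 2 * τ * I) (uDir (2 * k + p)) z).im)‖ := norm_sum_le _ _
      _ ≤ ∑ j ∈ Finset.range (J + 1), (2 * (24 * B)) := by
          refine Finset.sum_le_sum fun j hj => (norm_sum_le _ _).trans ?_
          refine (Finset.sum_le_sum fun p hp => (norm_sum_le _ _).trans
            (Finset.sum_le_sum fun k hk => hpiece j hj p hp k hk)).trans ?_
          simp only [Finset.sum_const, Finset.card_range, nsmul_eq_mul]; push_cast; rw [hB]
      _ = ((J + 1 : ℕ) : ℝ) * (48 * B) := by rw [Finset.sum_const, Finset.card_range, nsmul_eq_mul]; ring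
      _ ≤ (5 * Real.log V) * (48 * B) := mul_le_mul_of_nonneg_right hJlog (by positivity)
      _ = 28800 * pieceK * stepC ^ 2 * V ^ (1 / 3 : ℝ) * Real.log V ^ 2 := by rw [hB]; ring
  -- ### conclusion
  have hfin : 28800 * pieceK * stepC ^ 2 * V ^ (1 / 3 : ℝ) * Real.log V ^ 2 + 49152 * D₀ * V ^ (1 / 3 : ℝ)
      ≤ A * V ^ (1 / 3 : ℝ) * Real.log V ^ 2 := by
    rw [hAdef]
    have hVl : V ^ (1 / 3 : ℝ) ≤ V ^ (1 / 3 : ℝ) * Real.log V ^ 2 :=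
      le_mul_of_one_le_right (by positivity) (by nlinarith [hlog1])
    have h0 : 0 ≤ V ^ (1 / 3 : ℝ) * Real.log V ^ 2 := by positivity
    have h1 : 49152 * D₀ * V ^ (1 / 3 : ℝ) ≤ (90000 * D₀ + 1) * (V ^ (1 / 3 : ℝ) * Real.log V ^ 2) := by
      have := mul_le_mul_of_nonneg_left hVl (by positivity : (0:ℝ) ≤ 49152 * D₀)
      nlinarith [mul_nonneg hD₀.le h0]
    nlinarith [mul_nonneg (mul_nonneg hK0.le (by positivity : (0:ℝ) ≤ stepC ^ 2)) h0]
  linarith [hP, herr, hmain, hfin]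

/-- **Ricci's zero-density theorem for the family `{L(s, λ^m)}_{m ≤ K}`**: the named fact
`GaussianHecke.ricci_zeroDensity` ([cite: HuangLiuRudnick2020, Thm. 3]) holds, by `weyl_pointwise` and
`ricci_zeroDensity_of_pointwise`. [cite: HuangLiuRudnick2020, Thm. 3] -/
theorem ricci_zeroDensity_holds : ricci_zeroDensity := by
  obtain ⟨A, c, hA, h⟩ := weyl_pointwise
  exact ricci_zeroDensity_of_pointwise (c := c) hA h


end GaussianHecke

namespace VdC

end VdC
end Literature.NumberTheory.LFunctions

end
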